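import Mathlib
import Summits.ValiantsHypothesis.ValiantsHypothesis.Theses.FreeFermionCLL
import Summits.ValiantsHypothesis.ValiantsHypothesis.Theorems.FreeFermionCLLExpImpliesGap

/-!
# Route FreeFermionCLL — glued split of the deciding crux `PMCorrelationGap`
(stmt-ValiantsHypothesis-13555; crux-strategist BC2 redirect)

`PMCorrelationGap` (X: every principal-minor form `P = det(I_R + diag(x∘κ)·K)` of quasi-polynomial
total rank `R ≤ 2^((log₂ n + c)^c)` has `corr²(P^(n), per_n) ≤ 1/2` eventually in `n`) is split
along the READ-ONCE SEAM into

* `FreeFermionQPDecay` (child 1, the `R = n²` rung in its minimal form): for every `c`,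
  eventually in `n`, every READ-ONCE kernel `K ∈ ℂ^(n²×n²)` on the board has
  `2^((log₂ n + c)^c) · ‖permMass(FF_K^(n))‖² ≤ n! · coeffNormSq(FF_K^(n))`, i.e. the free-fermion
  overlap `corr²(FF_K^(n), per_n)` decays faster than every quasi-polynomial (weaker than the
  route's exponential `ReadOnceDecay`);
* `ColourMerging` (child 2, power form): there are `A, C` such that for all `n, R, K, κ` some
  read-once kernel `K'` on the board has
  `permCorrSq(P^(n))^(A+1) ≤ C · (R + n + 1)^C · permCorrSq(FF_{K'}^(n))` — colouring / merging
  modes of one variable buys at most a polynomial power and a polynomial factor over the best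
  read-once kernel at the same level.

The glue `pmCorrelationGap_of_subs : FreeFermionQPDecay → ColourMerging → PMCorrelationGap` is the
quasi-polynomial bookkeeping `2^(A+1) · C · (2^((L+c)^c) + n + 1)^C ≤ 2^((L + c')^c')` with
`c' = c + A + 4C + 2` (`L = Nat.log 2 n`, all `n`), followed by `ρ^(A+1) ≤ 2^-(A+1) ⇒ ρ ≤ 1/2` and
`2‖permMass‖² = 2ρ·(n!·coeffNormSq) ≤ n!·coeffNormSq` (`permCorrSq_mul_eq`).

No `def`s, no named facts, unconditional; the two children are written out verbatim as the
hypotheses (they become route decls only when the split is enacted).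
-/

set_option linter.dupNamespace false

namespace Summit.ValiantsHypothesis.ValiantsHypothesis.Theorems.FreeFermionCLLSplit

open Literature.Computability.AlgebraicComplexity
open Summit.ValiantsHypothesis.ValiantsHypothesis.Theses.FreeFermionCLL

/-! ## Quasi-polynomial arithmetic -/

/-- `m · (L + d)^d ≤ (L + (d + m))^(d + m)` for `1 ≤ m`: a natural multiple of a quasi-polynomial
exponent is absorbed by raising the constant. -/
theorem mul_qpExp_le (m d L : ℕ) (hm : 1 ≤ m) :
    m * (L + d) ^ d ≤ (L + (d + m)) ^ (d + m) := by
  have h1 : (L + d) ^ d ≤ (L + (d + m)) ^ d := Nat.pow_le_pow_left (by omega) d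
  have h2 : m ≤ (L + (d + m)) ^ m := by
    calc m ≤ L + (d + m) := by omega
      _ = (L + (d + m)) ^ 1 := (pow_one _).symm
      _ ≤ (L + (d + m)) ^ m := Nat.pow_le_pow_right (by omega) hm
  calc m * (L + d) ^ d ≤ (L + (d + m)) ^ m * (L + (d + m)) ^ d :=
        Nat.mul_le_mul h2 h1
    _ = (L + (d + m)) ^ (d + m) := by rw [← pow_add, Nat.add_comm m d]

/-- The exponent bookkeeping of the glue: with `a = (L + c)^c`,
`A + 1 + 2C + C·a + C·L ≤ (L + c')^c'` for `c' = c + A + 4C + 2`. -/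
theorem glue_exponent_le (A C c L : ℕ) :
    A + 1 + 2 * C + C * (L + c) ^ c + C * L ≤ (L + (c + A + 4 * C + 2)) ^ (c + A + 4 * C + 2) := by
  set d := c + 1 with hd
  have hbase : 1 ≤ L + d := by omega
  have ha : (L + c) ^ c ≤ (L + d) ^ d := by
    calc (L + c) ^ c ≤ (L + d) ^ c := Nat.pow_le_pow_left (by omega) c
      _ ≤ (L + d) ^ d := Nat.pow_le_pow_right hbase (by omega)
  have hL : L ≤ (L + d) ^ d := by
    calc L ≤ L + d := by omega
      _ = (L + d) ^ 1 := (pow_one _).symm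
      _ ≤ (L + d) ^ d := Nat.pow_le_pow_right hbase (by omega)
  have h1 : 1 ≤ (L + d) ^ d := Nat.one_le_pow _ _ hbase
  set m := A + 1 + 4 * C with hm
  have hsum : A + 1 + 2 * C + C * (L + c) ^ c + C * L ≤ m * (L + d) ^ d := by
    have e1 : (A + 1 + 2 * C) * 1 ≤ (A + 1 + 2 * C) * (L + d) ^ d := Nat.mul_le_mul_left _ h1
    have e2 : C * (L + c) ^ c ≤ C * (L + d) ^ d := Nat.mul_le_mul_left _ ha
    have e3 : C * L ≤ C * (L + d) ^ d := Nat.mul_le_mul_left _ hL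
    calc A + 1 + 2 * C + C * (L + c) ^ c + C * L
        ≤ (A + 1 + 2 * C) * (L + d) ^ d + C * (L + d) ^ d + C * (L + d) ^ d := by
          simpa using Nat.add_le_add (Nat.add_le_add e1 e2) e3
      _ = m * (L + d) ^ d := by rw [hm]; ring
  calc A + 1 + 2 * C + C * (L + c) ^ c + C * L ≤ m * (L + d) ^ d := hsum
    _ ≤ (L + (d + m)) ^ (d + m) := mul_qpExp_le m d L (by omega)
    _ = (L + (c + A + 4 * C + 2)) ^ (c + A + 4 * C + 2) := by
        have : d + m = c + A + 4 * C + 2 := by omega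
        rw [this]

/-- For `1 ≤ p` and `1 ≤ q`: `2^p + 2^q ≤ 2^(p+q)`. -/
theorem two_pow_add_two_pow_le (p q : ℕ) (hp : 1 ≤ p) (hq : 1 ≤ q) :
    2 ^ p + 2 ^ q ≤ 2 ^ (p + q) := by
  have h2p : 2 ≤ 2 ^ p := by
    calc 2 = 2 ^ 1 := by norm_num
      _ ≤ 2 ^ p := Nat.pow_le_pow_right (by norm_num) hp
  have h2q : 2 ≤ 2 ^ q := by
    calc 2 = 2 ^ 1 := by norm_num
      _ ≤ 2 ^ q := Nat.pow_le_pow_right (by norm_num) hq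
  rw [pow_add]
  nlinarith

/-- The glue's natural-number inequality: for all `A C c n`,
`2^(A+1) · C · (2^((log₂ n + c)^c) + n + 1)^C ≤ 2^((log₂ n + c')^c')` with `c' = c + A + 4C + 2`. -/
theorem glue_nat_bound (A C c n : ℕ) :
    2 ^ (A + 1) * C * (2 ^ ((Nat.log 2 n + c) ^ c) + n + 1) ^ C ≤
      2 ^ ((Nat.log 2 n + (c + A + 4 * C + 2)) ^ (c + A + 4 * C + 2)) := by
  set L := Nat.log 2 n with hL
  set a := (L + c) ^ c with ha
  have hn : n < 2 ^ (L + 1) := Nat.lt_pow_succ_log_self (by norm_num) n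
  have ha1 : 1 ≤ a := by
    rcases Nat.eq_zero_or_pos c with h | h
    · simp [ha, h]
    · exact Nat.one_le_pow _ _ (by omega)
  -- `2^a + n + 1 ≤ 2^(a + L + 1)`
  have hbase : 2 ^ a + n + 1 ≤ 2 ^ (a + (L + 1)) := by
    calc 2 ^ a + n + 1 ≤ 2 ^ a + 2 ^ (L + 1) := by omega
      _ ≤ 2 ^ (a + (L + 1)) := two_pow_add_two_pow_le a (L + 1) ha1 (by omega)
  have hpow : (2 ^ a + n + 1) ^ C ≤ 2 ^ (C * (a + L + 1)) := by
    calc (2 ^ a + n + 1) ^ C ≤ (2 ^ (a + (L + 1))) ^ C := Nat.pow_le_pow_left hbase C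
      _ = 2 ^ (C * (a + L + 1)) := by rw [← pow_mul]; ring_nf
  have hC : C ≤ 2 ^ C := (Nat.lt_two_pow_self).le
  calc 2 ^ (A + 1) * C * (2 ^ a + n + 1) ^ C
      ≤ 2 ^ (A + 1) * 2 ^ C * 2 ^ (C * (a + L + 1)) :=
        Nat.mul_le_mul (Nat.mul_le_mul_left _ hC) hpow
    _ = 2 ^ (A + 1 + 2 * C + C * a + C * L) := by
        rw [← pow_add, ← pow_add]; ring_nf
    _ ≤ 2 ^ ((L + (c + A + 4 * C + 2)) ^ (c + A + 4 * C + 2)) :=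
        Nat.pow_le_pow_right (by norm_num) (by simpa [ha] using glue_exponent_le A C c L)

/-! ## The glue -/

/-- **Glued split of `PMCorrelationGap`** (shape `C₁ → C₂ → C` for
`ledger route edit --split PMCorrelationGap --glue-by`): free-fermion super-quasi-polynomial decay
(child `FreeFermionQPDecay`) and the colour-merging comparison (child `ColourMerging`, power form)
imply the target gap. -/
theorem pmCorrelationGap_of_subs
    (h₁ : ∀ c : ℕ, ∃ n₀ : ℕ, ∀ n ≥ n₀, ∀ (K : Matrix (Fin n × Fin n) (Fin n × Fin n) ℂ),
      (2 : ℝ) ^ ((Nat.log 2 n + c) ^ c) *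
          ‖Literature.Computability.AlgebraicComplexity.permMass n
              (MvPolynomial.homogeneousComponent n
                (1 + Matrix.diagonal (fun e : Fin n × Fin n => MvPolynomial.X e) *
                  K.map (fun a : ℂ => (MvPolynomial.C a : MvPolynomial (Fin n × Fin n) ℂ))).det)‖ ^ 2 ≤
        (n.factorial : ℝ) *
          Literature.Computability.AlgebraicComplexity.coeffNormSq n
            (MvPolynomial.homogeneousComponent n
              (1 + Matrix.diagonal (fun e : Fin n × Fin n => MvPolynomial.X e) *
                K.map (fun a : ℂ => (MvPolynomial.C a : MvPolynomial (Fin n × Fin n) ℂ))).det))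
    (h₂ : ∃ A C : ℕ, ∀ (n R : ℕ) (K : Matrix (Fin R) (Fin R) ℂ) (κ : Fin R → Fin n × Fin n),
      ∃ K' : Matrix (Fin n × Fin n) (Fin n × Fin n) ℂ,
        Literature.Computability.AlgebraicComplexity.permCorrSq n
              (MvPolynomial.homogeneousComponent n
                (1 + Matrix.diagonal (fun i => MvPolynomial.X (κ i)) *
                  K.map (fun a : ℂ => (MvPolynomial.C a : MvPolynomial (Fin n × Fin n) ℂ))).det) ^ (A + 1) ≤
          (C : ℝ) * ((R : ℝ) + n + 1) ^ C *
            Literature.Computability.AlgebraicComplexity.permCorrSq n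
              (MvPolynomial.homogeneousComponent n
                (1 + Matrix.diagonal (fun e : Fin n × Fin n => MvPolynomial.X e) *
                  K'.map (fun a : ℂ => (MvPolynomial.C a : MvPolynomial (Fin n × Fin n) ℂ))).det)) :
    PMCorrelationGap := by
  obtain ⟨A, C, hCM⟩ := h₂
  unfold PMCorrelationGap
  intro c
  obtain ⟨n₀, hn₀⟩ := h₁ (c + A + 4 * C + 2)
  refine ⟨n₀, fun n hn R hR K κ => ?_⟩
  obtain ⟨K', hK'⟩ := hCM n R K κ
  have hdec := hn₀ n hn K'
  -- abbreviations: the coloured form `P`, the read-once form `F`, their correlations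
  set P := MvPolynomial.homogeneousComponent n
      (1 + Matrix.diagonal (fun i => MvPolynomial.X (κ i)) *
        K.map (fun a : ℂ => (MvPolynomial.C a : MvPolynomial (Fin n × Fin n) ℂ))).det with hP
  set F := MvPolynomial.homogeneousComponent n
      (1 + Matrix.diagonal (fun e : Fin n × Fin n => MvPolynomial.X e) *
        K'.map (fun a : ℂ => (MvPolynomial.C a : MvPolynomial (Fin n × Fin n) ℂ))).det with hF
  set a : ℕ := (Nat.log 2 n + c) ^ c with ha
  set a' : ℕ := (Nat.log 2 n + (c + A + 4 * C + 2)) ^ (c + A + 4 * C + 2) with ha'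
  set ρ : ℝ := permCorrSq n P with hρ
  set ρ' : ℝ := permCorrSq n F with hρ'
  set N : ℝ := (n.factorial : ℝ) * coeffNormSq n P with hN
  have hN0 : 0 ≤ N := mul_nonneg (Nat.cast_nonneg _) (coeffNormSq_nonneg _)
  have hρ0 : 0 ≤ ρ := permCorrSq_nonneg _
  have hρ'0 : 0 ≤ ρ' := permCorrSq_nonneg _
  have hmass : ‖permMass n P‖ ^ 2 = ρ * N := (permCorrSq_mul_eq P).symm
  -- child 1 at `c' = c + A + 4C + 2`: `2^a' · ρ' ≤ 1`
  have h2a' : (0 : ℝ) < (2 : ℝ) ^ a' := pow_pos two_pos _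
  have hρ'le : ρ' ≤ ((2 : ℝ) ^ a')⁻¹ := by
    rw [hρ', permCorrSq_le_iff (inv_nonneg.2 h2a'.le), inv_mul_eq_div, le_div_iff₀ h2a']
    calc ‖permMass n F‖ ^ 2 * 2 ^ a' = 2 ^ a' * ‖permMass n F‖ ^ 2 := mul_comm _ _
      _ ≤ (n.factorial : ℝ) * coeffNormSq n F := hdec
  have h3 : (2 : ℝ) ^ a' * ρ' ≤ 1 := by
    calc (2 : ℝ) ^ a' * ρ' ≤ (2 : ℝ) ^ a' * ((2 : ℝ) ^ a')⁻¹ :=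
          mul_le_mul_of_nonneg_left hρ'le h2a'.le
      _ = 1 := mul_inv_cancel₀ h2a'.ne'
  -- the rank bound and the quasi-polynomial bookkeeping
  have hR' : (R : ℝ) ≤ (2 : ℝ) ^ a := by exact_mod_cast hR
  have hY : ((R : ℝ) + n + 1) ^ C ≤ ((2 : ℝ) ^ a + n + 1) ^ C :=
    pow_le_pow_left₀ (by positivity) (by linarith) C
  have hg : (2 : ℝ) ^ (A + 1) * C * ((2 : ℝ) ^ a + n + 1) ^ C ≤ (2 : ℝ) ^ a' := by
    have := glue_nat_bound A C c n
    exact_mod_cast this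
  -- chain: `(2ρ)^(A+1) = 2^(A+1) ρ^(A+1) ≤ 2^(A+1) C (2^a+n+1)^C ρ' ≤ 2^a' ρ' ≤ 1`
  have h1 : ρ ^ (A + 1) ≤ (C : ℝ) * ((2 : ℝ) ^ a + n + 1) ^ C * ρ' := by
    calc ρ ^ (A + 1) ≤ (C : ℝ) * ((R : ℝ) + n + 1) ^ C * ρ' := hK'
      _ ≤ (C : ℝ) * ((2 : ℝ) ^ a + n + 1) ^ C * ρ' := by
          apply mul_le_mul_of_nonneg_right _ hρ'0
          exact mul_le_mul_of_nonneg_left hY (Nat.cast_nonneg C)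
  have hkey : (2 * ρ) ^ (A + 1) ≤ 1 := by
    calc (2 * ρ) ^ (A + 1) = (2 : ℝ) ^ (A + 1) * ρ ^ (A + 1) := mul_pow _ _ _
      _ ≤ (2 : ℝ) ^ (A + 1) * ((C : ℝ) * ((2 : ℝ) ^ a + n + 1) ^ C * ρ') :=
          mul_le_mul_of_nonneg_left h1 (pow_nonneg zero_le_two _)
      _ = ((2 : ℝ) ^ (A + 1) * C * ((2 : ℝ) ^ a + n + 1) ^ C) * ρ' := by ring
      _ ≤ (2 : ℝ) ^ a' * ρ' := mul_le_mul_of_nonneg_right hg hρ'0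
      _ ≤ 1 := h3
  have hρhalf : 2 * ρ ≤ 1 := by
    have h := (pow_le_pow_iff_left₀ (by positivity : (0 : ℝ) ≤ 2 * ρ) zero_le_one
      (Nat.succ_ne_zero A)).1 (by simpa using hkey)
    exact h
  -- conclusion: `2‖permMass P‖² = 2ρN ≤ N`
  rw [hmass]
  nlinarith [hρhalf, hN0]

/-! ## The route's exponential rung implies child 1 -/

/-- **`ReadOnceDecay → FreeFermionQPDecay`**: the route's rank-2 crux (exponential decay of the
free-fermion overlap, `corr² ≤ C·θⁿ`) implies child 1 (decay faster than every quasi-polynomial),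
because `2·C·(2^((log₂ n + c)^c) + n + 1)^C·θⁿ ≤ 1` eventually
(`eventually_quasipoly_mul_geom_le_one`). So a proof of `ReadOnceDecay` closes child 1. -/
theorem freeFermionQPDecay_of_readOnceDecay (h : ReadOnceDecay) :
    ∀ c : ℕ, ∃ n₀ : ℕ, ∀ n ≥ n₀, ∀ (K : Matrix (Fin n × Fin n) (Fin n × Fin n) ℂ),
      (2 : ℝ) ^ ((Nat.log 2 n + c) ^ c) *
          ‖Literature.Computability.AlgebraicComplexity.permMass n
              (MvPolynomial.homogeneousComponent n
                (1 + Matrix.diagonal (fun e : Fin n × Fin n => MvPolynomial.X e) *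
                  K.map (fun a : ℂ => (MvPolynomial.C a : MvPolynomial (Fin n × Fin n) ℂ))).det)‖ ^ 2 ≤
        (n.factorial : ℝ) *
          Literature.Computability.AlgebraicComplexity.coeffNormSq n
            (MvPolynomial.homogeneousComponent n
              (1 + Matrix.diagonal (fun e : Fin n × Fin n => MvPolynomial.X e) *
                K.map (fun a : ℂ => (MvPolynomial.C a : MvPolynomial (Fin n × Fin n) ℂ))).det) := by
  obtain ⟨C, θ, hθ0, hθ1, hRO⟩ := h
  intro c
  obtain ⟨n₀, hn₀⟩ := Theorems.FreeFermionCLL.eventually_quasipoly_mul_geom_le_one C c hθ0 hθ1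
  refine ⟨n₀, fun n hn K => ?_⟩
  have hlaw := hRO n K
  have hkey := hn₀ n hn
  set F := MvPolynomial.homogeneousComponent n
      (1 + Matrix.diagonal (fun e : Fin n × Fin n => MvPolynomial.X e) *
        K.map (fun a : ℂ => (MvPolynomial.C a : MvPolynomial (Fin n × Fin n) ℂ))).det with hF
  set N : ℝ := (n.factorial : ℝ) * coeffNormSq n F with hN
  set a : ℕ := (Nat.log 2 n + c) ^ c with ha
  have hN0 : 0 ≤ N := mul_nonneg (Nat.cast_nonneg _) (coeffNormSq_nonneg _)
  have hθn : 0 ≤ θ ^ n := pow_nonneg hθ0.le n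
  by_cases hC : C = 0
  · subst hC
    have h0 : ‖permMass n F‖ ^ 2 ≤ 0 := by simpa using hlaw
    have h0' : ‖permMass n F‖ ^ 2 = 0 := le_antisymm h0 (sq_nonneg _)
    rw [h0', mul_zero]
    exact hN0
  · have hC1 : 1 ≤ C := Nat.one_le_iff_ne_zero.2 hC
    have hb : (1 : ℝ) ≤ (2 : ℝ) ^ a + n + 1 := by
      have : (1 : ℝ) ≤ (2 : ℝ) ^ a := one_le_pow₀ (by norm_num)
      have : (0 : ℝ) ≤ n := Nat.cast_nonneg n
      linarith
    have h2a : (2 : ℝ) ^ a ≤ ((2 : ℝ) ^ a + n + 1) ^ C := by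
      calc (2 : ℝ) ^ a = ((2 : ℝ) ^ a) ^ 1 := (pow_one _).symm
        _ ≤ ((2 : ℝ) ^ a + n + 1) ^ 1 := by
            rw [pow_one, pow_one]; have : (0 : ℝ) ≤ n := Nat.cast_nonneg n; linarith
        _ ≤ ((2 : ℝ) ^ a + n + 1) ^ C := pow_le_pow_right₀ hb hC1
    have hCθN : 0 ≤ (C : ℝ) * θ ^ n * N := by positivity
    calc (2 : ℝ) ^ a * ‖permMass n F‖ ^ 2 ≤ (2 : ℝ) ^ a * ((C : ℝ) * θ ^ n * N) :=
          mul_le_mul_of_nonneg_left hlaw (by positivity)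
      _ ≤ ((2 : ℝ) ^ a + n + 1) ^ C * ((C : ℝ) * θ ^ n * N) :=
          mul_le_mul_of_nonneg_right h2a hCθN
      _ = (1 / 2) * (2 * (C : ℝ) * ((2 : ℝ) ^ a + n + 1) ^ C * θ ^ n) * N := by ring
      _ ≤ (1 / 2) * 1 * N := by
          apply mul_le_mul_of_nonneg_right _ hN0
          exact mul_le_mul_of_nonneg_left hkey (by norm_num)
      _ ≤ N := by linarith

end Summit.ValiantsHypothesis.ValiantsHypothesis.Theorems.FreeFermionCLLSplit
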